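import Summits.Ventures.DiscreteObjects.PP12.OrderElevenTriangleKernel
import Summits.Ventures.DiscreteObjects.PP12.OrderElevenTriangleRowCode

/-!
# PP(12), order-11 cell, Case B (`NoTriangleData12`): SOUNDNESS of the φ-walker (designs g23)
Framing: lottery ticket; floor = certified bounds/negative ranges.

Cell pub-namedobj (venture DiscreteObjects), target (M). `pwalkFrom v L` (`OrderElevenTriangleKernel`) walks the normalised orthomorphisms `φ` of `Z₁₁`
(`φ 0 = 0`, `φ` and `t ↦ t − φ t` injective) with `φ 1 = v` in increasing lexicographic order and consumes the literal list `L` at each of them. Here: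
**`pwalk_complete`** — if the walk succeeds (`= true`) then the packed map `packPhi φ` (`OrderElevenTriangleRowCode`) of EVERY such `φ` is the low 44 bits
of some entry of `L`. Proof pattern as in `OrderElevenHomologyWalkSound` (designs g22): a successful walk only consumes list heads (`pwalk_suffix`), and the
true value passes both filters at every position (`pstep_true`), by induction on the fuel with the semantic prefix invariants `SV` / `SD`.
Proofs only; nothing here asserts a census statement. No `sorry`, no new axioms.
-/

namespace Summit.Ventures.DiscreteObjects.PP12

namespace Triangle12

open Function
open Fin.CommRing -- `Fin 11` as a commutative ring (scoped Mathlib instance): cyclic residue arithmetic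

/-- value of a difference in `Fin 11` -/
theorem val_sub11' (a b : Fin 11) : (a - b).val = (a.val + 11 - b.val) % 11 := by
  have h := Fin.val_add b (a - b)
  rw [add_sub_cancel] at h
  have := a.isLt; have := b.isLt; have := (a - b).isLt
  omega

/-! ### the φ-walker: a successful walk lists every normalised orthomorphism -/

section Walker

variable (φ : Fin 11 → Fin 11)

/-- the value mask of the prefix `t`: bit `v` ⇔ `v = φ u` for some `u < t` -/
def SV (t usedV : ℕ) : Prop := ∀ v : ℕ, usedV.testBit v = true ↔ ∃ u : Fin 11, u.val < t ∧ (φ u).val = v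

/-- the difference mask of the prefix `t`: bit `d` ⇔ `d = u − φ u` for some `u < t` -/
def SD (t usedD : ℕ) : Prop := ∀ d : ℕ, usedD.testBit d = true ↔ ∃ u : Fin 11, u.val < t ∧ (u - φ u).val = d

/-- a successful `pstep` only consumes: its output is a suffix of its input -/
theorem pstep_suffix {t uV uD P : ℕ} {W : ℕ → ℕ → ℕ → List ℕ → Option (List ℕ)}
    (hW : ∀ a b c r r', W a b c r = some r' → r' <:+ r) {v : ℕ} {rest rest' : List ℕ}
    (h : pstep t uV uD P W v rest = some rest') : rest' <:+ rest := by
  unfold pstep at h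
  split_ifs at h with h1 h2
  · cases h; exact List.suffix_refl _
  · cases h; exact List.suffix_refl _
  · exact hW _ _ _ _ _ h

/-- a successful `pwalkV` only consumes -/
theorem pwalkV_suffix {t uV uD P : ℕ} {W : ℕ → ℕ → ℕ → List ℕ → Option (List ℕ)}
    (hW : ∀ a b c r r', W a b c r = some r' → r' <:+ r) :
    ∀ (c : ℕ) {rest rest' : List ℕ}, pwalkV t uV uD P W c rest = some rest' → rest' <:+ rest
  | 0, rest, rest', h => by cases h; exact List.suffix_refl _
  | c + 1, rest, rest', h => by
    rw [pwalkV] at h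
    split at h
    · cases h
    · rename_i r hps
      exact (pwalkV_suffix hW c h).trans (pstep_suffix hW hps)

/-- a successful `pwalk` only consumes -/
theorem pwalk_suffix : ∀ (f t uV uD P : ℕ) (rest rest' : List ℕ), pwalk f t uV uD P rest = some rest' → rest' <:+ rest
  | 0, t, uV, uD, P, rest, rest', h => by
    unfold pwalk at h
    cases rest with
    | nil => simp at h
    | cons E r =>
      simp only at h
      split_ifs at h
      cases h; exact List.suffix_cons _ _
  | f + 1, t, uV, uD, P, rest, rest', h => by
    rw [pwalk] at h
    exact pwalkV_suffix (fun a b c r r' h' => pwalk_suffix f (t + 1) a b c r r' h') 10 h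

variable {φ} (hinj : Injective φ) (hdinj : Injective fun t => t - φ t) (h0 : φ 0 = 0)
include hinj hdinj

/-- the true value at position `t` passes `pstep`'s two filters and leads to the prefix-`t+1` state -/
theorem pstep_true {t : ℕ} (ht : t < 11) {uV uD : ℕ} (hV : SV φ t uV) (hD : SD φ t uD)
    (W : ℕ → ℕ → ℕ → List ℕ → Option (List ℕ)) (rest : List ℕ) :
    ∃ uV' uD', SV φ (t + 1) uV' ∧ SD φ (t + 1) uD' ∧
      pstep t uV uD (pkgo φ t) W (φ ⟨t, ht⟩).val rest = W uV' uD' (pkgo φ (t + 1)) rest := by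
  set v := (φ ⟨t, ht⟩).val with hv
  have hdv : ((⟨t, ht⟩ : Fin 11) - φ ⟨t, ht⟩).val = (t + 11 - v) % 11 := val_sub11' _ _
  have n1 : uV.testBit v ≠ true := fun h => by
    obtain ⟨u, hu, hu'⟩ := (hV v).1 h
    have := hinj (Fin.ext (hu'.trans hv)); subst this; exact lt_irrefl _ hu
  have n2 : uD.testBit ((t + 11 - v) % 11) ≠ true := fun h => by
    obtain ⟨u, hu, hu'⟩ := (hD _).1 h
    have := hdinj (Fin.ext (hu'.trans hdv.symm)); subst this; exact lt_irrefl _ hu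
  refine ⟨uV ||| (1 <<< v), uD ||| (1 <<< ((t + 11 - v) % 11)), fun w => ?_, fun d => ?_, ?_⟩
  · rw [Nat.testBit_or, Bool.or_eq_true, hV, Nat.testBit_shiftLeft]
    constructor
    · rintro (⟨u, hu, e⟩ | h)
      · exact ⟨u, by omega, e⟩
      · have hw : w = v := by
          simp only [Bool.and_eq_true, decide_eq_true_eq, Nat.testBit_one_eq_true_iff_self_eq_zero] at h
          omega
        exact ⟨⟨t, ht⟩, by simp, hw ▸ rfl⟩
    · rintro ⟨u, hu, e⟩
      by_cases hut : u.val < t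
      · exact Or.inl ⟨u, hut, e⟩
      · have : u = ⟨t, ht⟩ := Fin.ext (by simp; omega)
        subst this
        have hw : w = v := by rw [hv]; exact e.symm
        right; simp [hw]
  · rw [Nat.testBit_or, Bool.or_eq_true, hD, Nat.testBit_shiftLeft]
    constructor
    · rintro (⟨u, hu, e⟩ | h)
      · exact ⟨u, by omega, e⟩
      · have hw : d = (t + 11 - v) % 11 := by
          simp only [Bool.and_eq_true, decide_eq_true_eq, Nat.testBit_one_eq_true_iff_self_eq_zero] at h
          omega
        exact ⟨⟨t, ht⟩, by simp, hw ▸ hdv⟩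
    · rintro ⟨u, hu, e⟩
      by_cases hut : u.val < t
      · exact Or.inl ⟨u, hut, e⟩
      · have : u = ⟨t, ht⟩ := Fin.ext (by simp; omega)
        subst this
        have hw : d = (t + 11 - v) % 11 := by rw [← e, hdv]
        right; simp [hw]
  · unfold pstep
    rw [if_neg n1, if_neg n2]
    congr 1
    simp [pkgo, ht, hv]

/-- the inner loop: if the true value is still ahead, a successful loop has listed `packPhi φ` (given the continuation does) -/
theorem pwalkV_true {t : ℕ} (ht : t < 11) {uV uD : ℕ} (hV : SV φ t uV) (hD : SD φ t uD)
    (W : ℕ → ℕ → ℕ → List ℕ → Option (List ℕ)) (hWs : ∀ a b c r r', W a b c r = some r' → r' <:+ r)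
    (hW : ∀ uV' uD' (r r' : List ℕ), SV φ (t + 1) uV' → SD φ (t + 1) uD' → W uV' uD' (pkgo φ (t + 1)) r = some r' →
      ∃ E ∈ r, E &&& 17592186044415 = packPhi φ) :
    ∀ (c : ℕ) (rest rest' : List ℕ), 11 - c ≤ (φ ⟨t, ht⟩).val →
      pwalkV t uV uD (pkgo φ t) W c rest = some rest' → ∃ E ∈ rest, E &&& 17592186044415 = packPhi φ
  | 0, rest, rest', hc, _ => by have := (φ ⟨t, ht⟩).isLt; omega
  | c + 1, rest, rest', hc, h => by
    rw [pwalkV] at h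
    split at h
    · cases h
    · rename_i r hps
      by_cases hv : 11 - (c + 1) = (φ ⟨t, ht⟩).val
      · obtain ⟨uV', uD', hV', hD', e⟩ := pstep_true hinj hdinj ht hV hD W rest
        rw [hv, e] at hps
        exact hW _ _ _ _ hV' hD' hps
      · obtain ⟨E, hE, hE'⟩ := pwalkV_true ht hV hD W hWs hW c r rest' (by omega) h
        exact ⟨E, (pstep_suffix hWs hps).subset hE, hE'⟩

include h0 in
/-- **soundness of the φ-walker**: a successful walk from a prefix-`t` state has listed `packPhi φ` -/
theorem pwalk_true : ∀ (f t : ℕ) (uV uD : ℕ) (rest rest' : List ℕ), t + f = 11 → 1 ≤ t → SV φ t uV → SD φ t uD →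
    pwalk f t uV uD (pkgo φ t) rest = some rest' → ∃ E ∈ rest, E &&& 17592186044415 = packPhi φ
  | 0, t, uV, uD, rest, rest', htf, _, _, _, h => by
    unfold pwalk at h
    cases rest with
    | nil => simp at h
    | cons E r =>
      simp only at h
      split_ifs at h with he
      have ht : t = 11 := by omega
      subst ht
      exact ⟨E, by simp, (beq_iff_eq.1 he : _)⟩
  | f + 1, t, uV, uD, rest, rest', htf, ht1, hV, hD, h => by
    rw [pwalk] at h
    have ht : t < 11 := by omega
    have hv0 : 1 ≤ (φ ⟨t, ht⟩).val := by
      by_contra hlt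
      have e : φ ⟨t, ht⟩ = φ 0 := by rw [h0]; exact Fin.ext (by omega)
      have := congrArg Fin.val (hinj e); simp at this; omega
    exact pwalkV_true hinj hdinj ht hV hD (pwalk f (t + 1)) (fun a b c r r' h' => pwalk_suffix f (t + 1) a b c r r' h')
      (fun uV' uD' r r' hV' hD' h' => pwalk_true f (t + 1) uV' uD' r r' (by omega) (by omega) hV' hD' h') 10 rest rest'
      (by omega) h

omit hinj hdinj in
include h0 in
/-- the prefix-`2` state of a normalised map with `φ 1 = v` -/
theorem state_two :
    SV φ 2 (1 ||| (1 <<< (φ 1).val)) ∧ SD φ 2 (1 ||| (1 <<< ((12 - (φ 1).val) % 11))) ∧ pkgo φ 2 = (φ 1).val <<< 4 := by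
  have two : ∀ u : Fin 11, u.val < 2 ↔ u = 0 ∨ u = 1 := fun u => by
    constructor
    · intro h; have : u.val = 0 ∨ u.val = 1 := by omega
      rcases this with h | h
      · exact Or.inl (Fin.ext h)
      · exact Or.inr (Fin.ext h)
    · rintro (rfl | rfl) <;> simp
  have bit1 : ∀ w k : ℕ, (Nat.testBit 1 w || (decide (w ≥ k) && Nat.testBit 1 (w - k))) = true ↔ w = 0 ∨ w = k := by
    intro w k
    rw [show (1 : ℕ) = 2 ^ 0 from rfl]
    simp only [Nat.testBit_two_pow, Bool.or_eq_true, decide_eq_true_eq, Bool.and_eq_true]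
    omega
  have hd1 : ((1 : Fin 11) - φ 1).val = (12 - (φ 1).val) % 11 := by rw [val_sub11']; simp
  refine ⟨fun w => ?_, fun d => ?_, ?_⟩
  · rw [Nat.testBit_or, Nat.testBit_shiftLeft, bit1]
    simp only [two]
    constructor
    · rintro (rfl | rfl)
      · exact ⟨0, Or.inl rfl, by simp [h0]⟩
      · exact ⟨1, Or.inr rfl, rfl⟩
    · rintro ⟨u, (rfl | rfl), e⟩
      · left; simpa [h0] using e.symm
      · exact Or.inr e.symm
  · rw [Nat.testBit_or, Nat.testBit_shiftLeft, bit1]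
    simp only [two]
    constructor
    · rintro (rfl | rfl)
      · exact ⟨0, Or.inl rfl, by simp [h0]⟩
      · exact ⟨1, Or.inr rfl, hd1⟩
    · rintro ⟨u, (rfl | rfl), e⟩
      · left; simpa [h0] using e.symm
      · exact Or.inr (e.symm.trans hd1)
  · simp [pkgo, h0]

include h0 in
/-- **completeness of the φ-table slice**: a normalised orthomorphism with `φ 1 = v` is listed by any slice the walker consumes exactly -/
theorem pwalk_complete {L : List ℕ} (hw : pwalkFrom (φ 1).val L = true) :
    ∃ E ∈ L, E &&& 17592186044415 = packPhi φ := by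
  obtain ⟨hV, hD, hP⟩ := state_two h0
  unfold pwalkFrom isSomeNil at hw
  split at hw
  · rename_i rest' h
    rw [← hP] at h
    exact pwalk_true hinj hdinj h0 9 2 _ _ L _ rfl (by norm_num) hV hD h
  · exact absurd hw Bool.false_ne_true

end Walker

end Triangle12

end Summit.Ventures.DiscreteObjects.PP12
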